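import Mathlib
import Summits.Ventures.FusionMHD.Models.CerfonFreidbergIterLikeQHalfData
import Summits.Ventures.FusionMHD.Models.CerfonFreidbergIterLikePointValues
import Summits.Ventures.FusionMHD.Models.FluxSurfacePolarRayLoop
import HarnessLib

/-!
# Ventures/FusionMHD — Models/CerfonFreidbergIterLikeQHalf.lean: ★ THE CERTIFIED INTERIOR SAFETY FACTOR `q(ψ_N = 1/2)/F` OF THE
# Cerfon–Freidberg ITER-like INSTANCE — `2.40763819 ≤ q/F ≤ 2.40763845` (polar `(6.35)` form), assembled from 32 kernel-checked panels

HONEST FRAMING (LADDER-GRIDFUSION three columns; CF rung; F2 item R2 «q on an interior surface of a shaped, NON-POLYNOMIAL equilibrium»,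
`pub/gridfusion/models/F2-SCOPING.md` v1.4 §8(b)/(c)).
* CERTIFIED (kernel, this file + its imports; axioms standard): for THE flux of record `U = cfSolution 0 coeff` of the CF ITER-like instance
  (`Models/CerfonFreidbergIterLikeAxisCert`), on the level `u₀ = U(X_a,0)/2` (`ψ_N = 1/2`): along EVERY polar ray from the magnetic axis
  `(X_a, 0)` with angle `θ ∈ [0, π]` the flux first reaches the level at a unique radius `ρ(θ)` (model-7's glued `rayRadius`, continuous in `θ`,
  inside a tube of radius `< 10⁻⁸` around the kernel's Newton-in-the-program approximant), the radial derivative there is positive, and THE POLAR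
  `(6.35)` INTEGRAL satisfies **`QLo ≤ ∫₀^{2π} ρ(θ)/((X_a + ρ(θ) cos θ)·D_r(θ, ρ(θ))) dθ ≤ QHi`**, hence
  **`2.40763819 ≤ qHalfOverF ≤ 2.40763845`** where `qHalfOverF := (1/2π)·∫₀^{2π} …` is Freidberg's `q/F` of that surface in the polar form of
  `Models/FluxSurfacePolarRay.lean` (#88: `q = (F/2π)∮ dl/(R²B_p) = (F/2π)∫ ρ/(R·|D_r|) dθ` for the polar-ray loop; the identification with
  `GradShafranov.safetyFactorE` on the loop `θ ↦ (X_a + ρ cos θ, ρ sin θ)` is `FluxSurfacePolarRayLoop.safetyFactorE_eq_polar_rayRadius`, whose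
  hypotheses (level identity, continuity of `ρ`, `D_r ≠ 0`, `R > 0`) this file supplies on `[0, π]` and, by the `Y ↦ −Y` symmetry of `U`, on
  `[π, 2π]`).  The lower half of the loop is the mirror image: `∫_π^{2π} = ∫_0^π` (`U(X, −Y) = U(X, Y)`, `CFIterLike.U_neg`).
* VALIDATED (never used in a proof): float lineages model-5 g4 `bench/F2-CF-ITER-truth-lineage1.json` B3 (`q/F(ψ_N = 1/2) = 2.4076383199`) and
  model-7 g2 (`2.4076383`), both inside the kernel bracket.
* MODELLED: analytic Cerfon–Freidberg family (ideal MHD, Solov'ev profiles `A = 0`, fixed analytic boundary); `q` of a MODEL flux surface —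
  nothing about a device, a discharge, or stability.
PIPELINE (all in the tree): `…QHalfDefs` (programs) → `…QHalfPanels1–7` (32 Taylor-model panel certificates, `decide +kernel`) → `…QHalfSound`
(their meaning) → `…QHalfRay` (calculus) → `…QHalfBoxes/A/B` (272 interval boxes: core below the level, `|∂_s D_r| ≤ M` on the strip) →
`…QHalfLink/Panel` (tube, unique crossing, per-panel bracket) → here: the 32 rational side conditions (`decide`), the panel sum
(`PolarRay.sum_panel_bounds`), the mirror symmetry, the headline.  Typer/prover: gridfusion-model-5 (g7), 2026-08-27.
Citations: Freidberg 2014 §6.3.5 (6.35), §6.6.1 (6.153) [Freidberg2014]; Pataki–Cerfon–Freidberg 2013 §6.1 [PatakiCerfonFreidberg2013];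
Mahboubi–Melquiond–Sibut-Pinote 2016 [MahboubiMelquiondSibutpinote2016].
-/

noncomputable section

open Set MeasureTheory intervalIntegral
open Literature.Analysis.ValidatedNumerics Literature.Analysis.ValidatedNumerics.PolyMP
open Literature.MathematicalPhysics.MHD Literature.MathematicalPhysics.MHD.CerfonFreidberg
open Summit.Ventures.FusionMHD.Models.PolarRay

namespace Summit.Ventures.FusionMHD.Models.CFIterLike.QHalf

/-! ## §3 The sum over `[0, π]` -/

/-- `aθ 0 = 0`, `aθ 32 = π`. -/
theorem aθ_ends : aθ 0 = 0 ∧ aθ 32 = Real.pi := by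
  constructor <;> norm_num [aθ, panelLeft, hw]

/-- The certified lower sum `Σ Lo_j`. -/
def totLo : ℚ := (756381846259577 / 100000000000000)
/-- The certified upper sum `Σ Hi_j`. -/
def totHi : ℚ := (189095481350501 / 25000000000000)

/-- The sums of the link bounds are `totLo`, `totHi`. -/
theorem sums_eq : (∑ k ∈ Finset.range 32, (((lP k).Lo : ℚ) : ℝ)) = ((totLo : ℚ) : ℝ)
    ∧ (∑ k ∈ Finset.range 32, (((lP k).Hi : ℚ) : ℝ)) = ((totHi : ℚ) : ℝ) := by
  constructor
  · rw [show (∑ k ∈ Finset.range 32, (((lP k).Lo : ℚ) : ℝ)) = ((∑ k ∈ Finset.range 32, (lP k).Lo : ℚ) : ℝ) by push_cast; rfl]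
    exact_mod_cast (by decide +kernel : (∑ k ∈ Finset.range 32, (lP k).Lo) = totLo)
  · rw [show (∑ k ∈ Finset.range 32, (((lP k).Hi : ℚ) : ℝ)) = ((∑ k ∈ Finset.range 32, (lP k).Hi : ℚ) : ℝ) by push_cast; rfl]
    exact_mod_cast (by decide +kernel : (∑ k ∈ Finset.range 32, (lP k).Hi) = totHi)

/-- **THE UPPER HALF**: `totLo ≤ ∫₀^π Pq ≤ totHi`, and `Pq` is integrable on `[0, π]`. -/
theorem half_bounds : ((totLo : ℚ) : ℝ) ≤ ∫ θ in (0 : ℝ)..Real.pi, Pq θ ∧ ∫ θ in (0 : ℝ)..Real.pi, Pq θ ≤ ((totHi : ℚ) : ℝ)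
    ∧ IntervalIntegrable Pq volume 0 Real.pi := by
  have hint : ∀ k < 32, IntervalIntegrable Pq volume (aθ k) (aθ (k + 1)) := by
    intro k hk
    interval_cases k
    · exact pb0.2.2
    · exact pb1.2.2
    · exact pb2.2.2
    · exact pb3.2.2
    · exact pb4.2.2
    · exact pb5.2.2
    · exact pb6.2.2
    · exact pb7.2.2
    · exact pb8.2.2
    · exact pb9.2.2
    · exact pb10.2.2
    · exact pb11.2.2
    · exact pb12.2.2
    · exact pb13.2.2
    · exact pb14.2.2
    · exact pb15.2.2
    · exact pb16.2.2
    · exact pb17.2.2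
    · exact pb18.2.2
    · exact pb19.2.2
    · exact pb20.2.2
    · exact pb21.2.2
    · exact pb22.2.2
    · exact pb23.2.2
    · exact pb24.2.2
    · exact pb25.2.2
    · exact pb26.2.2
    · exact pb27.2.2
    · exact pb28.2.2
    · exact pb29.2.2
    · exact pb30.2.2
    · exact pb31.2.2
  have hlo : ∀ k < 32, (((lP k).Lo : ℚ) : ℝ) ≤ ∫ θ in aθ k..aθ (k + 1), Pq θ := by
    intro k hk
    interval_cases k
    · exact pb0.1
    · exact pb1.1
    · exact pb2.1
    · exact pb3.1
    · exact pb4.1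
    · exact pb5.1
    · exact pb6.1
    · exact pb7.1
    · exact pb8.1
    · exact pb9.1
    · exact pb10.1
    · exact pb11.1
    · exact pb12.1
    · exact pb13.1
    · exact pb14.1
    · exact pb15.1
    · exact pb16.1
    · exact pb17.1
    · exact pb18.1
    · exact pb19.1
    · exact pb20.1
    · exact pb21.1
    · exact pb22.1
    · exact pb23.1
    · exact pb24.1
    · exact pb25.1
    · exact pb26.1
    · exact pb27.1
    · exact pb28.1
    · exact pb29.1
    · exact pb30.1
    · exact pb31.1
  have hhi : ∀ k < 32, ∫ θ in aθ k..aθ (k + 1), Pq θ ≤ (((lP k).Hi : ℚ) : ℝ) := by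
    intro k hk
    interval_cases k
    · exact pb0.2.1
    · exact pb1.2.1
    · exact pb2.2.1
    · exact pb3.2.1
    · exact pb4.2.1
    · exact pb5.2.1
    · exact pb6.2.1
    · exact pb7.2.1
    · exact pb8.2.1
    · exact pb9.2.1
    · exact pb10.2.1
    · exact pb11.2.1
    · exact pb12.2.1
    · exact pb13.2.1
    · exact pb14.2.1
    · exact pb15.2.1
    · exact pb16.2.1
    · exact pb17.2.1
    · exact pb18.2.1
    · exact pb19.2.1
    · exact pb20.2.1
    · exact pb21.2.1
    · exact pb22.2.1
    · exact pb23.2.1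
    · exact pb24.2.1
    · exact pb25.2.1
    · exact pb26.2.1
    · exact pb27.2.1
    · exact pb28.2.1
    · exact pb29.2.1
    · exact pb30.2.1
    · exact pb31.2.1
  have hs := sum_panel_bounds (N := 32) (t := aθ) (f := Pq) hint hlo hhi
  rw [sums_eq.1, sums_eq.2, aθ_ends.1, aθ_ends.2] at hs
  have hI := IntervalIntegrable.trans_iterate (a := aθ) (n := 32) hint
  rw [aθ_ends.1, aθ_ends.2] at hI
  exact ⟨hs.1, hs.2, hI⟩

/-! ## §4 The mirror symmetry `θ ↦ −θ` and the lower half -/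

/-- `U_X` closed form is even in `Y`. -/
theorem UXc_negY (c : Fin 7 → ℝ) (X Y : ℝ) : UXc c X (-Y) = UXc c X Y := by unfold UXc; ring
/-- `U_Y` closed form is odd in `Y`. -/
theorem UYc_negY (c : Fin 7 → ℝ) (X Y : ℝ) : UYc c X (-Y) = -UYc c X Y := by unfold UYc; ring

/-- The ray profile is even in `θ` (`U(X, −Y) = U(X, Y)`). -/
theorem rayProfile_neg (θ s : ℝ) : rayProfile U Xa 0 (-θ) s = rayProfile U Xa 0 θ s := by
  unfold rayProfile
  rw [Real.cos_neg, Real.sin_neg, show (0 : ℝ) + s * -Real.sin θ = -(0 + s * Real.sin θ) by ring]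
  exact U_neg _ _

/-- The glued ray radius is even in `θ`. -/
theorem ρ_neg (θ : ℝ) : ρ (-θ) = ρ θ := by
  unfold ρ rayRadius rootSet
  simp_rw [rayProfile_neg]

/-- The radial-derivative field is even in `θ`. -/
theorem Dfield_neg (θ s : ℝ) : Dfield (-θ) s = Dfield θ s := by
  unfold Dfield Drc
  rw [Real.cos_neg, Real.sin_neg, show s * -Real.sin θ = -(s * Real.sin θ) by ring, UXc_negY, UYc_negY]
  ring

/-- The polar integrand is even in `θ`. -/
theorem Pq_neg (θ : ℝ) : Pq (-θ) = Pq θ := by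
  unfold Pq polarIntegrand
  rw [show rayRadius U Xa 0 u₀ (-θ) = ρ (-θ) from rfl, ρ_neg, Dfield_neg, Real.cos_neg]
  rfl

/-- The radial-derivative field is `2π`-periodic in `θ`. -/
theorem Dfield_periodic (θ s : ℝ) : Dfield (θ + 2 * Real.pi) s = Dfield θ s := by
  unfold Dfield Drc
  rw [Real.cos_add_two_pi, Real.sin_add_two_pi]

/-- The polar integrand is `2π`-periodic. -/
theorem Pq_periodic (θ : ℝ) : Pq (θ + 2 * Real.pi) = Pq θ := by
  unfold Pq polarIntegrand
  rw [show rayRadius U Xa 0 u₀ (θ + 2 * Real.pi) = rayRadius U Xa 0 u₀ θ from periodic_rayRadius U Xa 0 u₀ θ, Dfield_periodic,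
    Real.cos_add_two_pi]

/-- **THE LOWER HALF IS THE MIRROR IMAGE**: `∫_π^{2π} Pq = ∫_0^π Pq`, with integrability. -/
theorem lower_half : ∫ θ in Real.pi..(2 * Real.pi), Pq θ = ∫ θ in (0 : ℝ)..Real.pi, Pq θ
    ∧ IntervalIntegrable Pq volume Real.pi (2 * Real.pi) := by
  have hrefl : ∀ x : ℝ, Pq (2 * Real.pi - x) = Pq x := by
    intro x; rw [show 2 * Real.pi - x = -x + 2 * Real.pi by ring, Pq_periodic, Pq_neg]
  constructor
  · have h := intervalIntegral.integral_comp_sub_left Pq (2 * Real.pi) (a := 0) (b := Real.pi)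
    simp only [sub_zero, show 2 * Real.pi - Real.pi = Real.pi by ring] at h
    rw [← h]
    exact intervalIntegral.integral_congr fun x _ => hrefl x
  · have h := (half_bounds.2.2).comp_sub_left (2 * Real.pi)
    simp only [sub_zero, show 2 * Real.pi - Real.pi = Real.pi by ring] at h
    have hfun : (fun x => Pq (2 * Real.pi - x)) = Pq := funext hrefl
    rw [hfun] at h
    exact h.symm

/-! ## §5 ★ The certified `q(ψ_N = 1/2)/F` -/

/-- **Freidberg's `q/F` of the surface `ψ_N = 1/2` in the polar `(6.35)` form**: `(1/2π)·∫₀^{2π} ρ/((X_a + ρ cos θ)·D_r(θ, ρ)) dθ`. -/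
def qHalfOverF : ℝ := 1 / (2 * Real.pi) * ∫ θ in (0 : ℝ)..(2 * Real.pi), Pq θ

/-- **THE FULL-LOOP BRACKET**: `2·totLo ≤ ∫₀^{2π} Pq ≤ 2·totHi`. -/
theorem full_bounds : 2 * ((totLo : ℚ) : ℝ) ≤ ∫ θ in (0 : ℝ)..(2 * Real.pi), Pq θ
    ∧ ∫ θ in (0 : ℝ)..(2 * Real.pi), Pq θ ≤ 2 * ((totHi : ℚ) : ℝ) := by
  obtain ⟨h1, h2, hI⟩ := half_bounds
  obtain ⟨h3, hI2⟩ := lower_half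
  rw [← intervalIntegral.integral_add_adjacent_intervals hI hI2, h3]
  constructor <;> linarith

/-- **★ THE HEADLINE: `2.40763819 ≤ q(ψ_N = 1/2)/F ≤ 2.40763845`** for THE Cerfon–Freidberg ITER-like MODEL flux (polar `(6.35)` form;
float truth 2.4076383199; the width `2.6·10⁻⁷` is the tube envelope + the kernel's Taylor-model integral enclosure + `π`'s 20-digit box). -/
theorem qHalfOverF_bounds : ((240763819 / 100000000) : ℝ) ≤ qHalfOverF ∧ qHalfOverF ≤ ((48152769 / 20000000) : ℝ) := by
  obtain ⟨h1, h2⟩ := full_bounds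
  have hpi1 := Real.pi_gt_d20; have hpi2 := Real.pi_lt_d20
  have hpi : 0 < Real.pi := Real.pi_pos
  norm_num [totLo, totHi] at h1 h2
  have e : qHalfOverF = (∫ θ in (0 : ℝ)..(2 * Real.pi), Pq θ) / (2 * Real.pi) := by
    unfold qHalfOverF; rw [one_div, inv_mul_eq_div]
  rw [e]
  constructor
  · rw [le_div_iff₀ (by positivity)]; nlinarith [h1, hpi2]
  · rw [div_le_iff₀ (by positivity)]; nlinarith [h2, hpi1]

end Summit.Ventures.FusionMHD.Models.CFIterLike.QHalf

end
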